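import Literature.AlgebraicGeometry.Resolution.OneDimAnalyticallyUnramified
import Literature.AlgebraicGeometry.Resolution.IntegralClosureEssFiniteType
import Literature.AlgebraicGeometry.Resolution.AdicQuotient
import Mathlib.AlgebraicGeometry.FunctionField
import Mathlib.AlgebraicGeometry.Noetherian
import Mathlib.AlgebraicGeometry.Morphisms.FiniteType
import Mathlib.RingTheory.KrullDimension.NonZeroDivisors
import Mathlib.RingTheory.LocalRing.RingHom.Basic
import HarnessLib

/-!
# Stub `stub_formalFibreReducedStalk` for crux stmt-ResolutionOfSingularities-15917
(`RadicialJung.CleanModels`, line `Sketch`, rev 7)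

**Height-one primes of the local rings of a variety are analytically unramified.** For an
integral scheme `V` locally of finite type over a field `k`, a point `v` with `dim 𝒪_{V,v} ≤ 2`
and a prime element `f` of `O = 𝒪_{V,v}`, the ring `Ô / f Ô` (`Ô` the `𝔪_v`-adic completion) is
reduced.

Proof (excellence input of the dimension-2 Zariski descent, in its classical form).
* `R := O / (f)` is a Noetherian local domain (`f` is prime) of Krull dimension `≤ 1`
  (`dim O/(f) + 1 ≤ dim O ≤ 2` for the non-zero-divisor `f`, Mathlib
  `ringKrullDim_quotient_succ_le_of_nonZeroDivisor`).
* `O` is essentially of finite type over `k` (`O` is essentially of finite type over the stalk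
  of `Spec k` at the image point, Mathlib `LocallyOfFiniteType.stalkMap`, and that stalk is a
  localisation of `k`), hence so is `R`; therefore the normalisation of `R` is a finite
  `R`-module (E. Noether's finiteness theorem, localised: the tree's
  `module_finite_integralClosure_of_essFiniteType`, Liu 2002 Prop. 4.1.27 + Stacks 0307).
* A one-dimensional Noetherian local domain with finite normalisation is analytically
  unramified: `R̂` is reduced (Krull 1930 / Kollár 2007 Thm. 1.101 (2) ⇒ (3), the tree's
  `isReduced_adicCompletion_of_finite_integralClosure`).
* Completion commutes with quotients: `Ô / f Ô ≃ (O/(f))^` (Matsumura Thm. 8.11, the tree's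
  `quotientCompletionEquiv`), where the `𝔪_v(O/(f))`-adic and `𝔪_{O/(f)}`-adic completions agree
  because `𝔪_v (O/(f)) = 𝔪_{O/(f)}` (`IsLocalRing.map_maximalIdeal_of_surjective`); reducedness
  transports along ring isomorphisms.

## References

* J. Kollár, *Lectures on Resolution of Singularities* (2007), Thm. 1.101. [Kollar2007]
* Q. Liu, *Algebraic Geometry and Arithmetic Curves* (2002), Prop. 4.1.27. [Liu2002]
* H. Matsumura, *Commutative Ring Theory* (1986), Thm. 8.11. [Matsumura1987]
-/

noncomputable section

set_option linter.dupNamespace false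

open CategoryTheory AlgebraicGeometry TopologicalSpace IsLocalRing
open Literature.AlgebraicGeometry.Resolution

namespace Summit.ResolutionOfSingularities.ResolutionOfSingularities.Theorems.RadicialJung.CleanModels

/-- **Local rings of schemes locally of finite type over a field are essentially of finite type**
over the field (for some, in fact for the canonical, `k`-algebra structure): `𝒪_{V,v}` is
essentially of finite type over the stalk of `Spec k` at the image point
(`LocallyOfFiniteType.stalkMap`), which is a localisation of `k`. -/
theorem exists_algebra_essFiniteType_stalk (k : Type) [Field k] (V : Scheme.{0})
    (f : V ⟶ Spec (.of k)) [LocallyOfFiniteType f] (v : V) :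
    ∃ _ : Algebra k (V.presheaf.stalk v), Algebra.EssFiniteType k (V.presheaf.stalk v) := by
  -- adapted from `exists_algebra_essFiniteType` (RadicialJungCleanModelsSufficeGameGerms.lean)
  let R := (Spec (CommRingCat.of k)).presheaf.stalk (f.base v)
  letI algRS : Algebra R (V.presheaf.stalk v) := (f.stalkMap v).hom.toAlgebra
  letI algkR : Algebra k R := StructureSheaf.stalkAlgebra (↑(CommRingCat.of k)) (f.base v)
  haveI : IsLocalization.AtPrime R (f.base v).asIdeal :=
    StructureSheaf.IsLocalization.to_stalk (↑(CommRingCat.of k)) (f.base v)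
  haveI : Algebra.EssFiniteType k R :=
    Algebra.EssFiniteType.of_isLocalization R (f.base v).asIdeal.primeCompl
  letI algkS : Algebra k (V.presheaf.stalk v) :=
    ((algebraMap R _).comp (algebraMap k R)).toAlgebra
  haveI : IsScalarTower k R (V.presheaf.stalk v) := IsScalarTower.of_algebraMap_eq' rfl
  haveI : Algebra.EssFiniteType R (V.presheaf.stalk v) := LocallyOfFiniteType.stalkMap f v
  exact ⟨algkS, Algebra.EssFiniteType.comp k R _⟩

/-- **Height-one primes of local rings essentially of finite type over a field, of dimension
`≤ 2`, are analytically unramified.** For a Noetherian local domain `O` essentially of finite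
type over a field `k` with `dim O ≤ 2` and a prime element `f ∈ O`, the ring `Ô / f Ô` is reduced:
`O/(f)` is a local domain of dimension `≤ 1`, essentially of finite type over `k`, so its
normalisation is finite (E. Noether) and its completion `(O/(f))^ ≃ Ô / f Ô` is reduced
(Krull 1930; Kollár 2007, Thm. 1.101). [cite: Kollar2007, Thm. 1.101] -/
theorem isReduced_adicCompletion_quotient_span_of_prime (k : Type) {O : Type} [Field k]
    [CommRing O] [IsDomain O] [IsNoetherianRing O] [IsLocalRing O] [Algebra k O]
    [Algebra.EssFiniteType k O] (hd2 : ringKrullDim O ≤ 2) {f : O} (hf : Prime f) :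
    IsReduced (AdicCompletion (maximalIdeal O) O ⧸
      Ideal.span {algebraMap O (AdicCompletion (maximalIdeal O) O) f}) := by
  obtain ⟨J, hJ⟩ : ∃ J : Ideal O, J = Ideal.span {f} := ⟨_, rfl⟩
  haveI hJp : J.IsPrime := hJ ▸ (Ideal.span_singleton_prime hf.ne_zero).mpr hf
  -- `R := O ⧸ J` is a Noetherian local domain of dimension `≤ 1`, essentially of finite type
  haveI : IsLocalRing (O ⧸ J) :=
    IsLocalRing.of_surjective' (Ideal.Quotient.mk J) Ideal.Quotient.mk_surjective
  have hdim : ringKrullDim (O ⧸ J) ≤ 1 := by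
    have h := ringKrullDim_quotient_succ_le_of_nonZeroDivisor
      (mem_nonZeroDivisors_of_ne_zero hf.ne_zero)
    rw [← hJ] at h
    have h2 : ringKrullDim (O ⧸ J) + 1 ≤ 1 + 1 :=
      (h.trans hd2).trans_eq one_add_one_eq_two.symm
    exact ENat.WithBot.add_le_add_one_right_iff.mp h2
  -- E. Noether, localised: the normalisation of `R` is finite
  haveI : Module.Finite (O ⧸ J) (integralClosure (O ⧸ J) (FractionRing (O ⧸ J))) :=
    module_finite_integralClosure_of_essFiniteType k (O ⧸ J) (FractionRing (O ⧸ J))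
  -- Krull / Kollár 1.101: `R^` is reduced
  have hred : IsReduced (AdicCompletion (maximalIdeal (O ⧸ J)) (O ⧸ J)) :=
    isReduced_adicCompletion_of_finite_integralClosure (O ⧸ J) hdim
  -- `𝔪 R = 𝔪_R`, so `R^` is also the `𝔪 R`-adic completion
  have hmax : (maximalIdeal O).map (Ideal.Quotient.mk J) = maximalIdeal (O ⧸ J) :=
    IsLocalRing.map_maximalIdeal_of_surjective _ Ideal.Quotient.mk_surjective
  haveI hred' :
      IsReduced (AdicCompletion ((maximalIdeal O).map (Ideal.Quotient.mk J)) (O ⧸ J)) := by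
    rw [hmax]; exact hred
  -- completion commutes with quotients: `Ô / J Ô ≃ R^`, and `J Ô = (ι f)`
  have hmap : Ideal.span {algebraMap O (AdicCompletion (maximalIdeal O) O) f} =
      J.map (algebraMap O (AdicCompletion (maximalIdeal O) O)) := by
    rw [hJ, Ideal.map_span, Set.image_singleton]
  have e := (Ideal.quotEquivOfEq hmap).trans (quotientCompletionEquiv (maximalIdeal O) J)
  exact isReduced_of_injective e e.injective

/-- STUB `stub_formalFibreReducedStalk` (dim-2 descent, excellence input) — **height-one primes of
the local rings of a variety are analytically unramified.** For an integral scheme `V` locally of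
finite type over a field `k`, a point `v` with `dim 𝒪_{V,v} ≤ 2` and a prime element `f₁` of
`𝒪_{V,v}`: the ring `Ô_{V,v} / f₁ Ô_{V,v} ≅ (𝒪_{V,v}/(f₁))^` is reduced — the one-dimensional local
domain `𝒪_{V,v}/(f₁)` is essentially of finite type over `k`, so its normalisation is finite
(E. Noether), which for one-dimensional Noetherian local domains forces a reduced completion
(Krull 1930 / Kollár 2007, Thm. 1.101; tree `isReduced_adicCompletion_of_finite_integralClosure`,
`quotientCompletionEquiv`). [cite: Kollar2007, Thm. 1.101] -/
theorem stub_formalFibreReducedStalk (k : Type) [Field k] (V : Scheme.{0}) [IsIntegral V]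
    (f : V ⟶ Spec (.of k)) [LocallyOfFiniteType f] (v : V)
    (hd2 : ringKrullDim (V.presheaf.stalk v) ≤ 2) (f₁ : V.presheaf.stalk v) (hf₁ : Prime f₁) :
    IsReduced (AdicCompletion (maximalIdeal (V.presheaf.stalk v)) (V.presheaf.stalk v) ⧸
      Ideal.span {algebraMap (V.presheaf.stalk v)
        (AdicCompletion (maximalIdeal (V.presheaf.stalk v)) (V.presheaf.stalk v)) f₁}) := by
  haveI : IsLocallyNoetherian V := LocallyOfFiniteType.isLocallyNoetherian f
  obtain ⟨_, _⟩ := exists_algebra_essFiniteType_stalk k V f v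
  exact isReduced_adicCompletion_quotient_span_of_prime k hd2 hf₁

end Summit.ResolutionOfSingularities.ResolutionOfSingularities.Theorems.RadicialJung.CleanModels

end
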